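import Summits.BirchSwinnertonDyer.BirchSwinnertonDyer.Theorems.EisensteinPrimesBSDpOnCellCTelescopeK2MemberTransportCore
import Summits.BirchSwinnertonDyer.BirchSwinnertonDyer.Theorems.EisensteinPrimesBSDpOnCellCTelescopeCarrierAlgOfWitness
import Summits.BirchSwinnertonDyer.BirchSwinnertonDyer.Theorems.EisensteinPrimesBSDpOnCellCRetractionSpecializationCyclic
import Summits.BirchSwinnertonDyer.BirchSwinnertonDyer.Theorems.ErratumRoadFiveSelfDualMemberInputs
import Summits.BirchSwinnertonDyer.BirchSwinnertonDyer.Theorems.UniversalToricDescentCharIdealVacuity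
import Literature.NumberTheory.EllipticCurves.SkinnerUrban2014.CofinitelyGeneratedSelmerProofs
import Literature.NumberTheory.EllipticCurves.CofreeTorsionFiniteness
import HarnessLib

/-!
# Crux 4 `BSDpOnCellC` (stmt-BirchSwinnertonDyer-19034), line «telescope», leaf N3′ `stub_memberControlMod` — THE PER-MEMBER BODY OF N3′
# FROM THE MEMBER CONTROL MAP: «`𝔛(g)` `Λ_𝒪`-torsion ⇒ a non-zero `t ∈ ℤ_p⟦T⟧` kills `X₂/π X₂`» and (ctrl) «`p^j · Ch(𝔛(g))·𝓞_{ℂ_p}⟦T⟧ ⊆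
# char_Λ(X₂/π X₂)·𝓞_{ℂ_p}⟦T⟧`» for ONE member, given N1's (fd_k)+(rat_k) and a control map `α : X₂/π X₂ → Sel(M₂[π])^∨` with `p`-power
# kernel bound and finite cokernel (helper, `--supports stmt-BirchSwinnertonDyer-19034`; closes nothing)

Cell `bsd-eis`, width seat `bsd-line-x2-p2` (prover g22, 2026-08-30; D-0154 KEY row 5). THEOREMS ONLY (no definition, no named fact, no
instance, no notation). HONEST FRAMING: no stub, no crux, no summit statement is proved; BSD is proved for no curve; the member control map
`α` is a HYPOTHESIS here (x2-p2 g21's `TelescopeK2MemberControlMapEventually` supplies it for all but finitely many members).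

SETTING. `Λ = ℤ_p⟦T⟧`, `B = ℤ_p⟦X⟧⟦T⟧` (`Λ`-algebra through `PowerSeries.map C`), `X₂ = XBig κ ρ₂ 𝔭̄ ∅` with a compatible `Λ`-structure (N3′'s
binders), `π = C (X − C x)` with `x ∈ 𝔪_{ℤ_p}`; a member datum `Δ : OrdinaryNewformDatum g p ι` (`g` of level `M`), `𝒪 = padicCoeffIntegers ι` with
`ℤ_p ↠ 𝒪` ((rat_k)), `A_g^† = Cofree Δ.selfDualRep _`, `ρ_g = Δ.selfDualCofreeRepOver K`, `𝔛(g) = XBig κ ρ_g 𝔭̄ ∅`; `θ : A₂[X − C x] →+ A_g^†` the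
quasi-isomorphism of (fd_k); `Y = Sel_{𝔭̄,∅}(K, M₂[π])^∨`.

* §1 algebra over `Λ`: a finitely generated torsion module over a domain has a non-zero annihilator (Mathlib
  `Submodule.annihilator_top_inter_nonZeroDivisors`); finite generation and torsion ASCEND along a linear map with finite cokernel
  (`moduleFinite_of_finite_quotient_range`, `isTorsion_of_finite_quotient_range`); the `Λ`-scalar `C(p^m)` acts on `B`-modules as `C((p : ℤ_p⟦X⟧)^m)`.
* §2 member inputs: `algebraMap ℤ_p 𝒪` is BIJECTIVE under (rat_k) (`bijective_algebraMap_padicCoeffIntegers`); `b ∘ algebraMap ℤ_p 𝒪 = R1.toCpInt p`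
  for every `b : 𝒪 → 𝓞_{ℂ_p}` over `ℚ̄_p → ℂ_p` (`comp_algebraMap_eq_toCpInt`); `𝔛(g)` is finitely generated over `𝒪⟦T⟧` for every admissible
  topology (`moduleFinite_XBig_selfDual`: Skinner–Urban Lemma 3.1.9 = tree `SkinnerUrban2014.moduleFinite_XBig`, with `A_g^†` `p`-primary /
  `p`-divisible / `A_g^†[p]` finite (tree `CofreeTorsionFiniteness`, `Cofree.divisible`; `𝒪/p` finite from (rat_k)) and unramified off `M p`
  (tree `SelfDualTwist.selfDualCofreeRepOver_localMap_inr_apply_eq_self`), then `Sel^∅ ≤ Sel^Σ`).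
* §3 **`memberControlMod_of_transport`** — THE PER-MEMBER BODY OF N3′ (its two conjuncts TOKEN FOR TOKEN with `(D k).ι ↦ ι`, `(D k).Δ ↦ Δ`,
  `x k ↦ x`) from: (fg) `Module.Finite B X₂`, (rat_k), (fd_k) (`θ` with its four clauses), a finite `Σ ⊇ {w ∣ M}`, and a `B`-linear
  `α : X₂/π X₂ → Y` with `ker α` killed by `C((p : ℤ_p⟦X⟧)^m)` and `Y ⧸ range α` finite. PROOF: `X₂/π X₂` is `Λ`-f.g. (x2-p2 g18
  `RetractionSpecialization.moduleFinite_quotSMulTop_of_retraction` at the evaluation retraction `X ↦ x`, LEAD g1 §E), hence so is `Y` (§1);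
  torsion of `𝔛(g)`, `Y`, `X₂/π X₂` are EQUIVALENT (this seat's `TelescopeK2MemberTransportCore.memberTransport` (i) + §1 through `α`); the torsion
  clause follows with §1's annihilator; (ctrl): off the torsion locus `char_Λ(X₂/π X₂) = ⊤` (tree `charIdeal_eq_top_of_not_isTorsion`), on it
  `memberTransport` (ii) gives `C(p^e)·Ch(𝔛(g)) ⊆ σ(char_Λ Y)` and the slack socket (`…CharIdealSlack.exists_span_pow_mul_charIdeal_le_of_ker` for
  `α|_Λ`) `C(p^m)^r · char_Λ Y ⊆ char_Λ(X₂/π X₂)`; push both through `PowerSeries.map b` using §2.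

What N3′ still needs beyond this file: `α` for EVERY member (tree: for all but finitely many, p761336) — as TYPED (∀ k) N3′ needs the per-member
local finiteness facts of memo #46 §4 (x2-p2 g21); the ∀ᶠk assembly on Cell C is this seat's next file.

References: R. Greenberg, LNM 1716 (1999) §4 [GreenbergLNM1716]; C. Skinner–E. Urban, Invent. Math. 195 (2014) Lemma 3.1.9, §3.1.6 [SkinnerUrban2014];
F. Castella, Camb. J. Math. 6 (2018) §2 and Erratum Lemma 2.1 [Castella2018Erratum]; N. Bourbaki, AC VII §4.4–4.5 [BourbakiAC5to7].
-/

set_option autoImplicit false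
set_option linter.dupNamespace false

noncomputable section

open scoped Classical

open NumberField IsDedekindDomain Field PowerSeries
  Literature.NumberTheory.EllipticCurves Literature.NumberTheory.EllipticCurves.GreenbergSelmer
  Literature.NumberTheory.GaloisRepresentations
  Literature.NumberTheory.EllipticCurves.BigGaloisRep
  Literature.NumberTheory.EllipticCurves.BigRepModule
  Literature.NumberTheory.EllipticCurves.ModularForms
  Summit.BirchSwinnertonDyer.Rank1Residual.X11b

namespace Summit.BirchSwinnertonDyer.BirchSwinnertonDyer.Theorems.TelescopeK2MemberControlModOfTransport

open Summit.BirchSwinnertonDyer.BirchSwinnertonDyer.Theorems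

/-! ## §1 Algebra over `Λ = ℤ_p⟦T⟧` -/

section Algebra

variable {Λ : Type*} [CommRing Λ] {P Q : Type*} [AddCommGroup P] [Module Λ P] [AddCommGroup Q] [Module Λ Q]

/-- **A finitely generated torsion module has a non-zero-divisor annihilator** (product of annihilators of generators; Mathlib
`Submodule.annihilator_top_inter_nonZeroDivisors`). [cite: BourbakiAC5to7, Ch. VII §4.4] -/
theorem exists_mem_nonZeroDivisors_forall_smul_eq_zero [Module.Finite Λ P] (hP : Module.IsTorsion Λ P) :
    ∃ t ∈ nonZeroDivisors Λ, ∀ m : P, t • m = 0 := by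
  obtain ⟨t, ht, ht0⟩ := Submodule.annihilator_top_inter_nonZeroDivisors hP
  exact ⟨t, ht0, fun m => Submodule.mem_annihilator.1 ht m Submodule.mem_top⟩

/-- **Finite generation ascends along a linear map with finite cokernel.** [folklore] -/
theorem moduleFinite_of_finite_quotient_range (f : P →ₗ[Λ] Q) [Module.Finite Λ P]
    [Finite (Q ⧸ LinearMap.range f)] : Module.Finite Λ Q := by
  refine ⟨Submodule.fg_of_fg_map_of_fg_inf_ker (LinearMap.range f).mkQ ?_ ?_⟩
  · rw [Submodule.map_top, Submodule.range_mkQ]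
    exact Module.Finite.fg_top
  · rw [top_inf_eq, Submodule.ker_mkQ, ← Submodule.map_top]
    exact Module.Finite.fg_top.map f

/-- **Torsion ascends along a linear map with finite cokernel**, provided the positive integers are non-zero-divisors of `Λ`: the
class of `y` in the finite quotient has finite order `n`, so `n • y = f x` with `x` torsion. [folklore] -/
theorem isTorsion_of_finite_quotient_range (f : P →ₗ[Λ] Q) [Finite (Q ⧸ LinearMap.range f)]
    (hn : ∀ n : ℕ, n ≠ 0 → (n : Λ) ∈ nonZeroDivisors Λ) (hP : Module.IsTorsion Λ P) : Module.IsTorsion Λ Q := by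
  intro y
  have hfin : IsOfFinAddOrder (Submodule.Quotient.mk (p := LinearMap.range f) y) := isOfFinAddOrder_of_finite _
  set n := addOrderOf (Submodule.Quotient.mk (p := LinearMap.range f) y) with hndef
  have hn0 : n ≠ 0 := (hfin.addOrderOf_pos).ne'
  have hmem : (n : Λ) • y ∈ LinearMap.range f := by
    rw [← Submodule.Quotient.mk_eq_zero, Submodule.Quotient.mk_smul, Nat.cast_smul_eq_nsmul, hndef,
      addOrderOf_nsmul_eq_zero]
  obtain ⟨x, hx⟩ := LinearMap.mem_range.1 hmem
  obtain ⟨⟨d, hd⟩, hdx⟩ := @hP x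
  refine ⟨⟨d * n, mul_mem hd (hn n hn0)⟩, ?_⟩
  change (d * (n : Λ)) • y = 0
  change d • x = 0 at hdx
  rw [mul_smul, ← hx, ← map_smul, hdx, map_zero]

/-- **Torsion descends along a linear map whose kernel is killed by a non-zero-divisor** (re-export of this seat's
`TelescopeK2MemberTransportCore.isTorsion_of_ker_smul` with membership phrasing). [cite: GreenbergLNM1716, §4] -/
theorem isTorsion_of_ker_smul_mem (f : P →ₗ[Λ] Q) {s : Λ} (hs : s ∈ nonZeroDivisors Λ)
    (hker : ∀ v ∈ LinearMap.ker f, s • v = 0) (hQ : Module.IsTorsion Λ Q) : Module.IsTorsion Λ P :=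
  TelescopeK2MemberTransportCore.isTorsion_of_ker_smul f hs (fun v hv => hker v (LinearMap.mem_ker.2 hv)) hQ

end Algebra

/-- Positive integers are non-zero-divisors of `ℤ_p⟦T⟧`. [folklore] -/
theorem natCast_mem_nonZeroDivisors_powerSeries {p : ℕ} [Fact p.Prime] (n : ℕ) (hn : n ≠ 0) :
    (n : PowerSeries ℤ_[p]) ∈ nonZeroDivisors (PowerSeries ℤ_[p]) := by
  refine mem_nonZeroDivisors_of_ne_zero fun h => ?_
  have h1 := congrArg (PowerSeries.constantCoeff (R := ℤ_[p])) h
  rw [map_natCast, map_zero] at h1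
  exact hn (Nat.cast_eq_zero.1 h1)

/-- The `Λ`-scalar `C(p^m)` acts on a `B`-module (`B = ℤ_p⟦X⟧⟦T⟧`, compatible structures) as the `B`-scalar `C((p : ℤ_p⟦X⟧)^m)`.
[folklore] -/
theorem C_pow_smul_eq {p : ℕ} [Fact p.Prime] {V : Type*} [AddCommGroup V] [Module (PowerSeries (PowerSeries ℤ_[p])) V]
    [Module (PowerSeries ℤ_[p]) V] [IsScalarTower (PowerSeries ℤ_[p]) (PowerSeries (PowerSeries ℤ_[p])) V] (m : ℕ) (v : V) :
    (PowerSeries.C ((p : ℤ_[p]) ^ m) : PowerSeries ℤ_[p]) • v =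
      (PowerSeries.C ((p : PowerSeries ℤ_[p]) ^ m) : PowerSeries (PowerSeries ℤ_[p])) • v := by
  rw [← algebraMap_smul (PowerSeries (PowerSeries ℤ_[p])) (PowerSeries.C ((p : ℤ_[p]) ^ m) : PowerSeries ℤ_[p]) v,
    TelescopeK2TorsionBigRepIdentification.algebraMap_powerSeries_eq, PowerSeries.map_C]
  congr 2
  change PowerSeries.C ((p : ℤ_[p]) ^ m) = (p : PowerSeries ℤ_[p]) ^ m
  rw [map_pow, map_natCast]

/-! ## §2 Member inputs -/

section Member

variable {p : ℕ} [Fact p.Prime] {M : ℕ} {kk : ℤ} {g : CuspForm (CongruenceSubgroup.Gamma0 M) kk}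
  (ι : coeffField g →+* PadicAlgCl p)

/-- **`ℤ_p → 𝒪 = padicCoeffIntegers ι` is BIJECTIVE under (rat_k)**: it is injective (a composite of `ℤ_p ⊂ ℚ_p` and a field embedding,
co-restricted) and surjective by hypothesis. [cite: EmertonPollackWeston2006, §3.1 (p. 17)] -/
theorem bijective_algebraMap_padicCoeffIntegers (hrat : Function.Surjective (algebraMap ℤ_[p] (padicCoeffIntegers ι))) :
    Function.Bijective (algebraMap ℤ_[p] (padicCoeffIntegers ι)) := by
  refine ⟨fun r s h => ?_, hrat⟩
  have h1 := congrArg (fun y : padicCoeffIntegers ι => (y : padicCoeffField ι)) h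
  simp only [padicCoeffIntegers.algebraMap_padicInt_eq, padicCoeffIntegers.coe_ofPadicInt] at h1
  exact Subtype.coe_injective ((algebraMap ℚ_[p] (padicCoeffField ι)).injective h1)

/-- **`b ∘ (ℤ_p → 𝒪) = (ℤ_p → 𝓞_{ℂ_p})`** for every ring map `b : 𝒪 → 𝓞_{ℂ_p}` lying over `ℚ̄_p → ℂ_p` (the compatibility clause of N3′'s
(ctrl_k)): both send `r` to the image of `r ∈ ℚ_p` in `ℂ_p`. [folklore] -/
theorem comp_algebraMap_eq_toCpInt (b : padicCoeffIntegers ι →+* 𝓞_ℂ_[p])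
    (hb : ∀ y, ((b y : 𝓞_ℂ_[p]) : ℂ_[p]) = algebraMap (PadicAlgCl p) ℂ_[p] (padicCoeffIntegers.toPadicAlgCl ι y)) :
    b.comp (algebraMap ℤ_[p] (padicCoeffIntegers ι)) = R1.toCpInt p := by
  refine RingHom.ext fun r => Subtype.ext ?_
  have h : (((algebraMap ℚ_[p] (padicCoeffField ι) (r : ℚ_[p])) : padicCoeffField ι) : PadicAlgCl p) =
      algebraMap ℚ_[p] (PadicAlgCl p) (r : ℚ_[p]) := by
    rw [IsScalarTower.algebraMap_apply ℚ_[p] (padicCoeffField ι) (PadicAlgCl p)]; rfl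
  rw [RingHom.comp_apply, hb, R1.coe_toCpInt, padicCoeffIntegers.toPadicAlgCl_apply,
    padicCoeffIntegers.algebraMap_padicInt_eq, padicCoeffIntegers.coe_ofPadicInt, h,
    ← IsScalarTower.algebraMap_apply ℚ_[p] (PadicAlgCl p) ℂ_[p]]

/-- **`𝒪/p𝒪` is finite under (rat_k)** (`ℤ_p/p ≃ 𝔽_p` is finite and surjects onto `𝒪/p`).
[cite: NeukirchANT1999, Ch. II (4.8)] -/
theorem finite_quotient_span_p (hrat : Function.Surjective (algebraMap ℤ_[p] (padicCoeffIntegers ι))) :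
    Finite (padicCoeffIntegers ι ⧸ Ideal.span {(p : padicCoeffIntegers ι)}) := by
  -- `ℤ_p/p ≃ 𝔽_p` is finite, and `ℤ_p/p ↠ 𝒪/p`
  have hker : Ideal.span {(p : ℤ_[p])} = RingHom.ker (PadicInt.toZMod : ℤ_[p] →+* ZMod p) := by
    rw [PadicInt.ker_toZMod, PadicInt.maximalIdeal_eq_span_p]
  haveI : Finite (ℤ_[p] ⧸ Ideal.span {(p : ℤ_[p])}) :=
    Finite.of_equiv (ZMod p) ((Ideal.quotEquivOfEq hker).trans
      (RingHom.quotientKerEquivOfSurjective (ZMod.ringHom_surjective PadicInt.toZMod))).symm.toEquiv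
  have hle : Ideal.span {(p : ℤ_[p])} ≤
      (Ideal.span {(p : padicCoeffIntegers ι)}).comap (algebraMap ℤ_[p] (padicCoeffIntegers ι)) := by
    rw [Ideal.span_singleton_le_iff_mem, Ideal.mem_comap, map_natCast]
    exact Ideal.mem_span_singleton_self _
  exact Finite.of_surjective (Ideal.quotientMap (Ideal.span {(p : padicCoeffIntegers ι)})
    (algebraMap ℤ_[p] (padicCoeffIntegers ι)) hle) (Ideal.quotientMap_surjective hrat)

variable (Δ : OrdinaryNewformDatum g p ι) {K : Type} [Field K] [NumberField K]

set_option maxHeartbeats 1600000 in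
set_option synthInstance.maxHeartbeats 80000 in
/-- **`𝔛(g) = XBig κ (A_g^†|_{Γ_K}) 𝔮 ∅` is a finitely generated `𝒪⟦T⟧`-module** (every admissible topology), under (rat_k): Skinner–Urban
Lemma 3.1.9 (tree `SkinnerUrban2014.moduleFinite_XBig`) for `Σ ⊇ {w ∣ M}` finite — `A_g^†` is `p`-primary, `p`-divisible with `A_g^†[p]`
finite (tree `CofreeTorsionFiniteness`, `Cofree.divisible`) and `I_{K_w}` acts trivially at `w ∉ Σ`, `w ∤ p`
(`SelfDualTwist.selfDualCofreeRepOver_localMap_inr_apply_eq_self`) — followed by `Sel^∅ ≤ Sel^Σ` (dually a surjection).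
[cite: SkinnerUrban2014, Lemma 3.1.9 (p. 20)] [cite: Castella2018Erratum, Lemma 2.1 (p. 2)] -/
theorem moduleFinite_XBig_selfDual (hrat : Function.Surjective (algebraMap ℤ_[p] (padicCoeffIntegers ι)))
    (κ : ZpExtension K p) (𝔮 : HeightOneSpectrum (𝓞 K))
    (S : Set (HeightOneSpectrum (𝓞 K))) (hS : S.Finite) (hSM : ∀ w : HeightOneSpectrum (𝓞 K), w ∉ S → ((M : ℕ) : 𝓞 K) ∉ w.asIdeal)
    [TopologicalSpace (PowerSeries (padicCoeffIntegers ι))]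
    [ContinuousSMul (PowerSeries (padicCoeffIntegers ι))
      (BigRepModule (padicCoeffIntegers ι) p (Cofree Δ.selfDualRep (padicCoeffField ι)))] :
    Module.Finite (PowerSeries (padicCoeffIntegers ι))
      (XBig κ (Δ.selfDualCofreeRepOver K) 𝔮 (∅ : Set (HeightOneSpectrum (𝓞 K)))) := by
  haveI := finite_quotient_span_p ι hrat
  have hfin : {a : Cofree Δ.selfDualRep (padicCoeffField ι) | p • a = 0}.Finite :=
    Cofree.finite_setOf_nsmul_eq_zero Δ.selfDualRep p
      (Nat.cast_ne_zero.2 (Fact.out : p.Prime).ne_zero)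
  haveI hSig : Module.Finite (PowerSeries (padicCoeffIntegers ι)) (XBig κ (Δ.selfDualCofreeRepOver K) 𝔮 S) :=
    SkinnerUrban2014.moduleFinite_XBig κ 𝔮 S hS (Δ.selfDualCofreeRepOver K)
      (Cofree.exists_pow_psmul_eq_zero ι Δ.selfDualRep)
      (Cofree.divisible (padicCoeffField ι) Δ.selfDualRep (Fact.out : p.Prime).ne_zero) hfin
      (SelfDualTwist.selfDualCofreeRepOver_localMap_inr_apply_eq_self Δ K S hSM)
  -- `Sel^∅ ≤ Sel^Σ`, dually a surjection `XBig Σ ↠ XBig ∅`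
  have hle : selmerBig κ (Δ.selfDualCofreeRepOver K) 𝔮 (∅ : Set (HeightOneSpectrum (𝓞 K))) ≤
      selmerBig κ (Δ.selfDualCofreeRepOver K) 𝔮 S := selmerBig_mono κ _ 𝔮 (Set.empty_subset S)
  exact Module.Finite.of_surjective (CharacterModule.dual (Submodule.inclusion hle))
    (CharacterModule.dual_surjective_of_injective _ (Submodule.inclusion_injective hle))

end Member

/-! ## §3 The per-member body of N3′ from the member control map -/

section Body

variable {K : Type} [Field K] [NumberField K] {p : ℕ} [Fact p.Prime]
  {M : ℕ} {kk : ℤ} {g : CuspForm (CongruenceSubgroup.Gamma0 M) kk} {ι : coeffField g →+* PadicAlgCl p}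

set_option maxHeartbeats 1600000 in
/-- **THE PER-MEMBER BODY OF N3′ `stub_memberControlMod` FROM THE MEMBER CONTROL MAP.** For `X₂ = XBig κ ρ₂ 𝔭̄ ∅` finitely generated over
`B = ℤ_p⟦X⟧⟦T⟧` with a compatible `Λ`-structure, `x ∈ 𝔪_{ℤ_p}`, `π = C(X − C x)`, a member datum `Δ` of level `M` with (rat_k) `ℤ_p ↠ 𝒪`,
the quasi-isomorphism `θ : A₂[X − C x] → A_g^†` of (fd_k), a finite `Σ` with `(M) ⊆ w` only for `w ∈ Σ`, and a `B`-linear member control map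
`α : X₂/π X₂ → Y = Sel_{𝔭̄,∅}(K, M₂[π])^∨` whose kernel is killed by `C((p : ℤ_p⟦X⟧)^m)` and whose cokernel is finite:
(A) if `𝔛(g) = XBig κ (A_g^†|_{Γ_K}) 𝔭̄ ∅` is `𝒪⟦T⟧`-torsion (every admissible topology) then a non-zero `t ∈ ℤ_p⟦T⟧` kills `X₂/π X₂`;
(ctrl) for every `b : 𝒪 → 𝓞_{ℂ_p}` over `ℚ̄_p → ℂ_p` and every admissible topology, `C(p^j) · Ch(𝔛(g))^b ⊆ char_Λ(X₂/π X₂)^{toCpInt}` for some `j`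
— the two conjuncts of N3′'s per-member conclusion, TOKEN FOR TOKEN up to `(D k).ι ↦ ι`, `(D k).Δ ↦ Δ`, `x k ↦ x`.
[cite: GreenbergLNM1716, §4] [cite: SkinnerUrban2014, Lemma 3.1.9 and §3.1.6] [cite: Castella2018Erratum, Lemma 2.1 (p. 2)] -/
theorem memberControlMod_of_transport (κ : ZpExtension K p) (𝔭bar : HeightOneSpectrum (𝓞 K))
    [TopologicalSpace (PowerSeries ℤ_[p])] {A₂ : Type} [AddCommGroup A₂] [Module (PowerSeries ℤ_[p]) A₂]
    [TopologicalSpace A₂] [DiscreteTopology A₂]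
    (ρ₂ : ContinuousRep (absoluteGaloisGroup K) (PowerSeries ℤ_[p]) A₂)
    [TopologicalSpace (PowerSeries (PowerSeries ℤ_[p]))]
    [ContinuousSMul (PowerSeries (PowerSeries ℤ_[p])) (BigRepModule (PowerSeries ℤ_[p]) p A₂)]
    [Module (PowerSeries ℤ_[p]) (XBig κ ρ₂ 𝔭bar (∅ : Set (HeightOneSpectrum (𝓞 K))))]
    [IsScalarTower (PowerSeries ℤ_[p]) (PowerSeries (PowerSeries ℤ_[p]))
      (XBig κ ρ₂ 𝔭bar (∅ : Set (HeightOneSpectrum (𝓞 K))))]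
    (hfg : Module.Finite (PowerSeries (PowerSeries ℤ_[p])) (XBig κ ρ₂ 𝔭bar (∅ : Set (HeightOneSpectrum (𝓞 K)))))
    {x : ℤ_[p]} (hx : ‖x‖ < 1) (Δ : OrdinaryNewformDatum g p ι)
    (hrat : Function.Surjective (algebraMap ℤ_[p] (padicCoeffIntegers ι)))
    (θ : Submodule.torsionBy (PowerSeries ℤ_[p]) A₂ (PowerSeries.X - PowerSeries.C x) →+
      Cofree Δ.selfDualRep (padicCoeffField ι))
    (hθC : ∀ (c : ℤ_[p]) (a : Submodule.torsionBy (PowerSeries ℤ_[p]) A₂ (PowerSeries.X - PowerSeries.C x)),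
      θ (PowerSeries.C c • a) = algebraMap ℤ_[p] (padicCoeffIntegers ι) c • θ a)
    (hθG : ∀ (σ : absoluteGaloisGroup K) (a : Submodule.torsionBy (PowerSeries ℤ_[p]) A₂ (PowerSeries.X - PowerSeries.C x)),
      θ (BigGaloisRep.torsionRep ρ₂ (PowerSeries.X - PowerSeries.C x) σ a) = Δ.selfDualCofreeRepOver K σ (θ a))
    (hker : Finite θ.ker) (hcoker : Finite (Cofree Δ.selfDualRep (padicCoeffField ι) ⧸ θ.range))
    (S : Set (HeightOneSpectrum (𝓞 K))) (hS : S.Finite) (hSM : ∀ w : HeightOneSpectrum (𝓞 K), w ∉ S → ((M : ℕ) : 𝓞 K) ∉ w.asIdeal)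
    (α : QuotSMulTop (PowerSeries.C (PowerSeries.X - PowerSeries.C x : PowerSeries ℤ_[p]))
        (XBig κ ρ₂ 𝔭bar (∅ : Set (HeightOneSpectrum (𝓞 K)))) →ₗ[PowerSeries (PowerSeries ℤ_[p])]
      CharacterModule (TorsionControl.selmer (localMap K) (strictSet p 𝔭bar (∅ : Set (HeightOneSpectrum (𝓞 K))))
        (TorsionControl.torsionRep (AnticyclotomicBigGaloisRep κ ρ₂)
          (PowerSeries.C (PowerSeries.X - PowerSeries.C x : PowerSeries ℤ_[p])))))
    (m : ℕ) (hαker : ∀ v ∈ LinearMap.ker α,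
      (PowerSeries.C ((p : PowerSeries ℤ_[p]) ^ m) : PowerSeries (PowerSeries ℤ_[p])) • v = 0)
    (hαcoker : Finite ((CharacterModule (TorsionControl.selmer (localMap K) (strictSet p 𝔭bar (∅ : Set (HeightOneSpectrum (𝓞 K))))
        (TorsionControl.torsionRep (AnticyclotomicBigGaloisRep κ ρ₂)
          (PowerSeries.C (PowerSeries.X - PowerSeries.C x : PowerSeries ℤ_[p]))))) ⧸ LinearMap.range α)) :
    ((∀ [TopologicalSpace (PowerSeries (padicCoeffIntegers ι))]
        [ContinuousSMul (PowerSeries (padicCoeffIntegers ι))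
          (BigRepModule (padicCoeffIntegers ι) p (Cofree Δ.selfDualRep (padicCoeffField ι)))],
        Module.IsTorsion (PowerSeries (padicCoeffIntegers ι))
          (XBig κ (Δ.selfDualCofreeRepOver K) 𝔭bar (∅ : Set (HeightOneSpectrum (𝓞 K))))) →
      ∃ t : PowerSeries ℤ_[p], t ≠ 0 ∧
        ∀ v : QuotSMulTop (PowerSeries.C (PowerSeries.X - PowerSeries.C x))
          (XBig κ ρ₂ 𝔭bar (∅ : Set (HeightOneSpectrum (𝓞 K)))), t • v = 0) ∧
    ∀ (b : padicCoeffIntegers ι →+* 𝓞_ℂ_[p]),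
      (∀ y, ((b y : 𝓞_ℂ_[p]) : ℂ_[p]) =
        algebraMap (PadicAlgCl p) ℂ_[p] (padicCoeffIntegers.toPadicAlgCl ι y)) →
    ∀ [TopologicalSpace (PowerSeries (padicCoeffIntegers ι))]
      [ContinuousSMul (PowerSeries (padicCoeffIntegers ι))
        (BigRepModule (padicCoeffIntegers ι) p (Cofree Δ.selfDualRep (padicCoeffField ι)))],
      ∃ j : ℕ, Ideal.span {PowerSeries.C ((p : 𝓞_ℂ_[p]) ^ j)} *
          (XBig.charIdeal κ (Δ.selfDualCofreeRepOver K) 𝔭bar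
            (∅ : Set (HeightOneSpectrum (𝓞 K)))).map (PowerSeries.map b) ≤
        (Literature.NumberTheory.EllipticCurves.Module.charIdeal (PowerSeries ℤ_[p])
            (QuotSMulTop (PowerSeries.C (PowerSeries.X - PowerSeries.C x))
              (XBig κ ρ₂ 𝔭bar (∅ : Set (HeightOneSpectrum (𝓞 K)))))).map
          (PowerSeries.map (R1.toCpInt p)) := by
  -- abbreviations
  set Q : Type := QuotSMulTop (PowerSeries.C (PowerSeries.X - PowerSeries.C x : PowerSeries ℤ_[p]))
      (XBig κ ρ₂ 𝔭bar (∅ : Set (HeightOneSpectrum (𝓞 K))))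
  set Y : Type := CharacterModule (TorsionControl.selmer (localMap K) (strictSet p 𝔭bar (∅ : Set (HeightOneSpectrum (𝓞 K))))
      (TorsionControl.torsionRep (AnticyclotomicBigGaloisRep κ ρ₂)
        (PowerSeries.C (PowerSeries.X - PowerSeries.C x : PowerSeries ℤ_[p]))))
  /- §a scalar structures: `A₂` over `ℤ_p` (through `C`), `Y` over `Λ` (through `PowerSeries.map C`) -/
  letI : Module ℤ_[p] A₂ := Module.compHom A₂ (algebraMap ℤ_[p] (PowerSeries ℤ_[p]))
  haveI : IsScalarTower ℤ_[p] (PowerSeries ℤ_[p]) A₂ := IsScalarTower.of_algebraMap_smul fun _ _ => rfl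
  letI instY : Module (PowerSeries ℤ_[p]) Y := Module.compHom Y (algebraMap (PowerSeries ℤ_[p]) (PowerSeries (PowerSeries ℤ_[p])))
  haveI : IsScalarTower (PowerSeries ℤ_[p]) (PowerSeries (PowerSeries ℤ_[p])) Y :=
    IsScalarTower.of_algebraMap_smul fun _ _ => rfl
  haveI : Module.Finite (PowerSeries (PowerSeries ℤ_[p])) (XBig κ ρ₂ 𝔭bar (∅ : Set (HeightOneSpectrum (𝓞 K)))) := hfg
  /- §b `Q = X₂/π X₂` and `Y` are finitely generated over `Λ` -/
  have hxm : x ∈ IsLocalRing.maximalIdeal ℤ_[p] := by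
    rw [PadicInt.maximalIdeal_eq_span_p, Ideal.mem_span_singleton]
    exact (PadicInt.norm_lt_one_iff_dvd x).mp hx
  have hφC : ∀ t : PowerSeries ℤ_[p], PowerSeries.map (AccumHelpers.evAt x hxm).toRingHom
      (algebraMap (PowerSeries ℤ_[p]) (PowerSeries (PowerSeries ℤ_[p])) t) = t :=
    fun t => TelescopeCarrierAlgOfWitness.evAtMap_map_C _ hxm t
  have hφker : ∀ s : PowerSeries (PowerSeries ℤ_[p]), PowerSeries.map (AccumHelpers.evAt x hxm).toRingHom s = 0 →
      PowerSeries.C (PowerSeries.X - PowerSeries.C x) ∣ s :=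
    fun s hs => TelescopeCarrierAlgOfWitness.C_dvd_of_evAtMap_eq_zero _ hxm s hs
  haveI : Module.Finite (PowerSeries ℤ_[p]) Q :=
    RetractionSpecialization.moduleFinite_quotSMulTop_of_retraction hφC hφker
  let αΛ : Q →ₗ[PowerSeries ℤ_[p]] Y := α.restrictScalars (PowerSeries ℤ_[p])
  have hαΛ : ∀ v, αΛ v = α v := fun _ => rfl
  have hrange : LinearMap.range αΛ = (LinearMap.range α).restrictScalars (PowerSeries ℤ_[p]) := by
    ext y
    rw [LinearMap.mem_range, Submodule.restrictScalars_mem, LinearMap.mem_range]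
    exact ⟨fun ⟨v, hv⟩ => ⟨v, hv⟩, fun ⟨v, hv⟩ => ⟨v, hv⟩⟩
  haveI : Finite (Y ⧸ LinearMap.range αΛ) := by
    rw [hrange]
    exact Finite.of_equiv _ (Submodule.Quotient.restrictScalarsEquiv (PowerSeries ℤ_[p]) (LinearMap.range α)).symm.toEquiv
  haveI : Module.Finite (PowerSeries ℤ_[p]) Y := moduleFinite_of_finite_quotient_range αΛ
  have hCpm : (PowerSeries.C ((p : ℤ_[p]) ^ m) : PowerSeries ℤ_[p]) ∈ nonZeroDivisors (PowerSeries ℤ_[p]) := by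
    refine mem_nonZeroDivisors_of_ne_zero fun h => ?_
    have h1 := congrArg (PowerSeries.constantCoeff (R := ℤ_[p])) h
    rw [PowerSeries.constantCoeff_C, map_zero] at h1
    exact pow_ne_zero _ (Nat.cast_ne_zero.mpr (Fact.out : p.Prime).ne_zero) h1
  have hαkerΛ : ∀ v ∈ LinearMap.ker αΛ, (PowerSeries.C ((p : ℤ_[p]) ^ m) : PowerSeries ℤ_[p]) • v = 0 := fun v hv => by
    rw [C_pow_smul_eq]
    exact hαker v (by rwa [LinearMap.mem_ker, ← hαΛ])
  -- torsion of `Q` and `Y` are equivalent through `α`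
  have hQY : Module.IsTorsion (PowerSeries ℤ_[p]) Q ↔ Module.IsTorsion (PowerSeries ℤ_[p]) Y :=
    ⟨isTorsion_of_finite_quotient_range αΛ natCast_mem_nonZeroDivisors_powerSeries,
      isTorsion_of_ker_smul_mem αΛ hCpm hαkerΛ⟩
  /- §c the member transport core -/
  have hR := bijective_algebraMap_padicCoeffIntegers ι hrat
  have hC : ∀ y : Cofree Δ.selfDualRep (padicCoeffField ι), ∃ k : ℕ, p ^ k • y = 0 :=
    Cofree.exists_pow_psmul_eq_zero ι Δ.selfDualRep
  have hθC' : ∀ (r : ℤ_[p]) (a : Submodule.torsionBy (PowerSeries ℤ_[p]) A₂ (PowerSeries.X - PowerSeries.C x)),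
      θ (algebraMap ℤ_[p] (PowerSeries ℤ_[p]) r • a) = algebraMap ℤ_[p] (padicCoeffIntegers ι) r • θ a := fun r a => hθC r a
  have hθG' : ∀ (σ : absoluteGaloisGroup K) (a : Submodule.torsionBy (PowerSeries ℤ_[p]) A₂ (PowerSeries.X - PowerSeries.C x)),
      θ (TorsionControl.torsionRep ρ₂ (PowerSeries.X - PowerSeries.C x) σ a) = Δ.selfDualCofreeRepOver K σ (θ a) :=
    fun σ a => hθG σ a
  refine ⟨fun htor => ?_, fun b hb τ inst => ?_⟩
  · /- (A) the torsion clause: instantiate at the discrete topology on `𝒪⟦T⟧` -/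
    letI τ𝒪 : TopologicalSpace (PowerSeries (padicCoeffIntegers ι)) := ⊥
    haveI : DiscreteTopology (PowerSeries (padicCoeffIntegers ι)) := ⟨rfl⟩
    have core := TelescopeK2MemberTransportCore.memberTransport (𝒪 := PowerSeries ℤ_[p]) κ 𝔭bar ρ₂
      (PowerSeries.X - PowerSeries.C x) hR (Δ.selfDualCofreeRepOver K) θ hθC' hθG' hker hcoker hC
    have hY : Module.IsTorsion (PowerSeries ℤ_[p]) Y := core.1.mp htor
    obtain ⟨t, ht, htQ⟩ := exists_mem_nonZeroDivisors_forall_smul_eq_zero (hQY.mpr hY)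
    exact ⟨t, nonZeroDivisors.ne_zero ht, htQ⟩
  · /- (ctrl) -/
    by_cases hQ : Module.IsTorsion (PowerSeries ℤ_[p]) Q
    · have hY : Module.IsTorsion (PowerSeries ℤ_[p]) Y := hQY.mp hQ
      haveI : Module.Finite (PowerSeries (padicCoeffIntegers ι))
          (XBig κ (Δ.selfDualCofreeRepOver K) 𝔭bar (∅ : Set (HeightOneSpectrum (𝓞 K)))) :=
        moduleFinite_XBig_selfDual ι Δ hrat κ 𝔭bar S hS hSM
      have core := TelescopeK2MemberTransportCore.memberTransport (𝒪 := PowerSeries ℤ_[p]) κ 𝔭bar ρ₂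
        (PowerSeries.X - PowerSeries.C x) hR (Δ.selfDualCofreeRepOver K) θ hθC' hθG' hker hcoker hC
      obtain ⟨e, he⟩ := core.2 this inferInstance hY
      obtain ⟨r, hr⟩ :=
        BiquadraticEisensteinDescentEisensteinHeartFlatCMInertBadKPrimeCharIdealSlack.exists_span_pow_mul_charIdeal_le_of_ker
          hY hQ αΛ (PowerSeries.C ((p : ℤ_[p]) ^ m)) (fun v => Subtype.ext (hαkerΛ v.1 v.2))
      refine ⟨e + m * r, ?_⟩
      -- push `he` and `hr` through `PowerSeries.map b`, `b ∘ algebraMap = toCpInt`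
      have hcomp : (PowerSeries.map b).comp (PowerSeries.map (algebraMap ℤ_[p] (padicCoeffIntegers ι))) =
          PowerSeries.map (R1.toCpInt p) := by
        rw [← PowerSeries.map_comp, comp_algebraMap_eq_toCpInt ι b hb]
      have h1 := Ideal.map_mono (f := PowerSeries.map b) he
      rw [Ideal.map_mul, Ideal.map_span, Set.image_singleton, PowerSeries.map_C, Ideal.map_map, hcomp] at h1
      have h2 := Ideal.map_mono (f := PowerSeries.map (R1.toCpInt p)) hr
      rw [Ideal.map_mul, Ideal.map_span, Set.image_singleton, map_pow, PowerSeries.map_C] at h2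
      have hbp : b (algebraMap ℤ_[p] (padicCoeffIntegers ι) ((p : ℤ_[p]) ^ e)) = (p : 𝓞_ℂ_[p]) ^ e := by
        rw [← RingHom.comp_apply, comp_algebraMap_eq_toCpInt ι b hb, map_pow, map_natCast]
      have htp : R1.toCpInt p ((p : ℤ_[p]) ^ m) = (p : 𝓞_ℂ_[p]) ^ m := by rw [map_pow, map_natCast]
      rw [hbp] at h1
      rw [htp, ← map_pow, ← pow_mul] at h2
      calc Ideal.span {PowerSeries.C ((p : 𝓞_ℂ_[p]) ^ (e + m * r))} *
            (XBig.charIdeal κ (Δ.selfDualCofreeRepOver K) 𝔭bar (∅ : Set (HeightOneSpectrum (𝓞 K)))).map (PowerSeries.map b)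
          = Ideal.span {PowerSeries.C ((p : 𝓞_ℂ_[p]) ^ (m * r))} * (Ideal.span {PowerSeries.C ((p : 𝓞_ℂ_[p]) ^ e)} *
            (XBig.charIdeal κ (Δ.selfDualCofreeRepOver K) 𝔭bar (∅ : Set (HeightOneSpectrum (𝓞 K)))).map (PowerSeries.map b)) := by
            rw [← mul_assoc, Ideal.span_singleton_mul_span_singleton, ← map_mul, ← pow_add, Nat.add_comm (m * r) e]
        _ ≤ Ideal.span {PowerSeries.C ((p : 𝓞_ℂ_[p]) ^ (m * r))} *
            (Literature.NumberTheory.EllipticCurves.Module.charIdeal (PowerSeries ℤ_[p]) Y).map (PowerSeries.map (R1.toCpInt p)) :=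
            Ideal.mul_mono_right h1
        _ ≤ _ := h2
    · -- off the torsion locus the right-hand side is the unit ideal
      rw [UniversalToricDescentCharIdealVacuity.charIdeal_eq_top_of_not_isTorsion hQ, Ideal.map_top]
      exact ⟨0, le_top⟩

end Body

end Summit.BirchSwinnertonDyer.BirchSwinnertonDyer.Theorems.TelescopeK2MemberControlModOfTransport

end
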